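/-
COR-CM (cell pub-hodgecm2, stage 2 of the Hodge ladder) — count-neutral KERNEL CENSUS TRANSPORT «the MARKMAN COLUMN», degree 12, type
`D₆` (`DihedralGroup 6`, `c = r 3`) — enlarged generation binder and FIELD CLOSURE (seat prover-pub-hodgecm2-b23-g34-0, binder prover b23, gen 34; own lane DEG12-MARKMAN-TRANSPORT,
HOME/LIT-CLAIMS.md l.1451, HOME/INBOX.md l.5632; seat b07's ORBIT-COUNT v2 §7.3/§7.4 offer by adjacency; sequel of
`Census/DuodecicFaceTransportDihedral.lean` (b23) on seat b09's DECIC-MARKMAN pattern `Census/DecicFaceTransportOfMarkman.lean`, generic part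
`CorCM/FaceCensusMarkmanColumn.lean`).  Theorems only; no definition, no named fact, nothing asserted; the census data `Γ` of
`Census/DuodecicFaceGeneratorsDihedral.lean` BY NAME; `Interfaces.lean` (C1), every E term, `B01/*`, `Transposition/*` untouched.
HONEST FRAMING (COORDINATOR RULING — HODGE FRAMING CORRECTION, 2026-08-21T11:55:35Z): `HC_CM` is NOT proved, here or anywhere in the
tree; nothing here produces a period or proves a case of the Hodge conjecture.
T5 (coordinator ruling 15:33:56Z (3)): binder set of §4 = b23's landed `…_duodecicDihedral` set {dictionary (e, hmul, hconj), face readings,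
face periods} MINUS 4 face period(s) PLUS {type readings of `E₀`, `E₁`, `T₁`, `T₂`, `T₃`, `T₄` (inhabited:
`FaceCensus.exists_type_reads`), `hHC` ×4 (instances of the Hodge conjecture on tree abelian varieties; no `¬` theorem in the tree; supplied
modulo `Markman2025_weilClasses_algebraic_abelianFourfold` by seat b07's `CorCM/InducedCurveThreefoldHodgeOfMarkman.lean` once the types are
presented as induced types — NOT done in this file)}; no contradiction derivable; checker: self (prover-pub-hodgecm2-b23-g34-0), 2026-08-21.
-/
import Summits.HodgeConjecture.CorCM.Census.DuodecicFaceTransportDihedralOfMarkmanSpan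
import Summits.HodgeConjecture.CorCM.Census.DuodecicFaceTransportDihedral
import Summits.HodgeConjecture.CorCM.FacePeriodsKnownProducts
import HarnessLib

/-!
# Degree 12, type `D₆` (`DihedralGroup 6`, `c = r 3`): 4 face periods + the Markman FOURFOLD column close the slice (census transport)

Seat b23's `DuodecicFaceTransport.Dihedral.hodgeConjectureFor_of_avDominatedBy_isProductOf_of_facePeriod_duodecicDihedral` closes this slice of
the Hodge conjecture from period witnesses on 8 faces reading as the generating representatives `(455;9,18)`, `(455;9,36)`, `(455;9,576)`, `(455;9,1152)`, `(455;18,36)`, `(455;18,1152)`, `(462;36,1152)`, `(469;9,36)`.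
Here 4 of them (`(455;9,576)`, `(455;18,36)`, `(455;18,1152)`, `(462;36,1152)`) are replaced by KNOWN PRODUCTS — the Weil-fourfold families `E_a × T` of seat b07's
ORBIT-COUNT v2 §7 (HOME/pub-hodgecm2-b07/ORBIT-COUNT.md), read on the tree as Hodge weights of degree `2` on two-slot families `![E_a, T]` of
CM types of `K` given by their codes at `σ₀`:

* `E₀` READS AS `2730`: the type of `K` induced from the type `{σ̄₀|_{k₀}}` of the imaginary quadratic subfield `k₀ = K^{⟨r², s⟩}` (mask `2730` = complement of `Gal(K/k₀) = {0,2,4,6,8,10}`)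
* `E₁` READS AS `1386`: the type induced from `{σ̄₀|_{k₁}}`, `k₁ = K^{⟨r², sr⟩}` (mask `1386` = complement of `{0,2,4,7,9,11}`)
* `T₁` READS AS `952`: induced from the sextic CM subfield `L₀ = K^{⟨s⟩}` (left cosets `r³⟨s⟩ ∪ r⁴⟨s⟩ ∪ r⁵⟨s⟩`, mask `952`; a threefold type NOT induced from `k₀`)
* `T₂` READS AS `3598`: induced from `L₀ = K^{⟨s⟩}` (`r⟨s⟩ ∪ r²⟨s⟩ ∪ r³⟨s⟩`, mask `3598`)
* `T₃` READS AS `924`: induced from `L₅ = K^{⟨sr⁵⟩}` (`r²⟨sr⁵⟩ ∪ r³⟨sr⁵⟩ ∪ r⁴⟨sr⁵⟩`, mask `924`; NOT induced from `k₁`)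
* `T₄` READS AS `1806`: induced from `L₅ = K^{⟨sr⁵⟩}` (`r⟨sr⁵⟩ ∪ r²⟨sr⁵⟩ ∪ r³⟨sr⁵⟩`, mask `1806`)

(weights `W₁` on `![E₀, T₁]` = codes `(2730, 952)`, slots `[0]`, `[5, 1, 3]` (labels `[476, 1841, 2730, 3143]`); `W₂` on `![E₀, T₂]` = codes `(2730, 3598)`, slots `[0]`, `[3, 5, 1]` (labels `[497, 1799, 2730, 3164]`); `W₃` on `![E₁, T₃]` = codes `(1386, 924)`, slots `[0]`, `[0, 4, 2]` (labels `[924, 1386, 2247, 3633]`); `W₄` on `![E₁, T₄]` = codes `(1386, 1806)`, slots `[0]`, `[5, 3, 1]` (labels `[903, 1386, 2289, 3612]`); certificates `Census/DuodecicFaceTransportDihedralOfMarkmanCerts.lean`, unwinding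
`Census/DuodecicFaceTransportDihedralOfMarkmanSpan.lean`).  §3: b23's binder `hgen_duodecicDihedral`, applied to `𝒮` enlarged by faces reading as the dropped
representatives (they exist: `FaceCensus.exists_face_reads`), with those faces eliminated at every base embedding
(`FaceCensus.lefChar_corner_mem_closure_known_of_weightRel_mem`, seat b09), gives the ENLARGED generation binder; §4
(`hodgeConjectureFor_of_avDominatedBy_isProductOf_of_exists_facePeriod_of_hodgeConjectureFor_on`, seat b09's `CorCM/FacePeriodsKnownProducts.lean`):

  period witnesses on the 4 faces `(455;9,18)`, `(455;9,36)`, `(455;9,1152)`, `(469;9,36)` of `K` + `HodgeConjectureFor` of the 4 tree products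
  `cmProdAV K cmAbelianVarietyRealised_holds 1 ![E_a, T]`
    ⟹ the Hodge conjecture, in every codimension, for every abelian variety dominated by a product of realisations of CM types of CM fields
      embeddable in `K`.

LATTICE FACTS (exact model, seat folder `work/markman_d6.py`, `minfam.py`): the corner vectors of the kept cells and the 32 divisor pairs span a
sublattice of corank 2 of the rank-58 Pohlmann–Hodge lattice; with the twelve Weil-fourfold monomials the span is everything (index 1); FOUR of
them suffice for the dropped representatives and no three do.  By seat b17's kernel bound `four_le_card_of_generates` (`Census/DodecicDihedralMinimality.lean`) four orbits is optimal for `D₆`.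
`HC_CM` is NOT proved; no period is produced here.

References: [cite: Pohlmann1968, Thm. 1]; [cite: Milne1999LefschetzClasses, Thm. 3.2 and Cor. 4.5]; [cite: Shimura1998, §6.2 Theorem 3 and
§6.1 Corollary of Theorem 2 (pp. 41–43)]; [cite: MumfordAV1970, §19 Thm. 1 and p. 169]; [cite: Markman2025SurveySecant, Thm. 1.2] (only through
the hypotheses `hHC`).
-/

noncomputable section

open CategoryTheory NumberField NumberField.ComplexEmbedding
open Literature.AlgebraicGeometry Literature.AlgebraicGeometry.Motives Literature.AlgebraicGeometry.HodgeTheory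
open Literature.AlgebraicGeometry.ComplexMultiplication Literature.AlgebraicGeometry.Milne1999
open Literature.NumberTheory.Automorphic Literature.NumberTheory.Automorphic.PicardCM
open Literature.NumberTheory.ComplexMultiplication.CMTypeOps
open Summit.HodgeConjecture.CorCM.Prior.AllgGroup.RfwfAllgGroup
open Summit.HodgeConjecture.CorCM.Census.FaceSquaresModel
open Summit.HodgeConjecture.CorCM.Census.DuodecicFaceGeneratorsDihedral (Γ)
open Summit.HodgeConjecture.CorCM.DuodecicFaceTransport.Dihedral (hgen_duodecicDihedral)
open Summit.HodgeConjecture.CorCM.FaceCensus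
open Summit.HodgeConjecture.CorCM.Domination

namespace Summit.HodgeConjecture.CorCM.DuodecicFaceTransport.DihedralMarkman

/-! ## §3 The ENLARGED generation binder, type `D₆` (`DihedralGroup 6`, `c = r 3`), Markman column -/

/-- **The ENLARGED generation binder, type `D₆` (`DihedralGroup 6`, `c = r 3`), Markman FOURFOLD column.** `K` a Galois CM field with an enumeration
`e : GalT K ≃ Fin 12` multiplicative for b30's table with `e conjT = 3`; `σ₀` a base embedding; `𝒮` any set of faces containing faces
`R₁`, `R₂`, `R₄`, `R₈` READING AS `(455;9,18)`, `(455;9,36)`, `(455;9,1152)`, `(469;9,36)`; CM types `E₀`, `E₁`, `T₁`, `T₂`, `T₃`, `T₄` of `K` reading as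
`2730`, `1386`, `952`, `3598`, `924`, `1806`; `𝒲` any set of families containing `![E₀, T₁]`, `![E₀, T₂]`, `![E₁, T₃]`, `![E₁, T₄]`.  Then the `σ₀`-Weil character of EVERY face of `K`
lies in the subgroup generated by the Weil characters of `𝒮` and the Hodge-weight characters of `𝒲` (b23's binder `hgen_duodecicDihedral` with
the dropped faces, which exist by `FaceCensus.exists_face_reads`, eliminated through §2 at every base embedding).
[cite: Pohlmann1968, Thm. 1] [cite: Milne1999LefschetzClasses, Thm. 3.2] -/
theorem hgen_duodecicDihedral_markman (K : CMField) [IsGalois ℚ K] (e : GalT K ≃ Fin 12)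
    (hmul : ∀ P Q : GalT K, e (P * Q) = Γ.mul (e P) (e Q)) (hconj : e conjT = Γ.conj) (σ₀ : (K : Type) →+* ℂ)
    (𝒮 : Set (Face K)) (𝒲 : Set ((m : ℕ) × (Fin (m + 1) → CMType K))) (R₁ R₂ R₄ R₈ : Face K)
    (hR₁S : R₁ ∈ 𝒮) (hR₁ : (∀ P : GalT K, P.1 σ₀ ∈ R₁.Φ.1 ↔ mem (e P) 455 = true) ∧
      Γ.placeMask (e (translate σ₀ R₁.p)) = 9 ∧ Γ.placeMask (e (translate σ₀ R₁.p')) = 18)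
    (hR₂S : R₂ ∈ 𝒮) (hR₂ : (∀ P : GalT K, P.1 σ₀ ∈ R₂.Φ.1 ↔ mem (e P) 455 = true) ∧
      Γ.placeMask (e (translate σ₀ R₂.p)) = 9 ∧ Γ.placeMask (e (translate σ₀ R₂.p')) = 36)
    (hR₄S : R₄ ∈ 𝒮) (hR₄ : (∀ P : GalT K, P.1 σ₀ ∈ R₄.Φ.1 ↔ mem (e P) 455 = true) ∧
      Γ.placeMask (e (translate σ₀ R₄.p)) = 9 ∧ Γ.placeMask (e (translate σ₀ R₄.p')) = 1152)
    (hR₈S : R₈ ∈ 𝒮) (hR₈ : (∀ P : GalT K, P.1 σ₀ ∈ R₈.Φ.1 ↔ mem (e P) 469 = true) ∧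
      Γ.placeMask (e (translate σ₀ R₈.p)) = 9 ∧ Γ.placeMask (e (translate σ₀ R₈.p')) = 36)
    (E₀ E₁ T₁ T₂ T₃ T₄ : CMType K)
    (hE₀ : (∀ P : GalT K, P.1 σ₀ ∈ E₀.1 ↔ mem (e P) 2730 = true))
    (hE₁ : (∀ P : GalT K, P.1 σ₀ ∈ E₁.1 ↔ mem (e P) 1386 = true))
    (hT₁ : (∀ P : GalT K, P.1 σ₀ ∈ T₁.1 ↔ mem (e P) 952 = true))
    (hT₂ : (∀ P : GalT K, P.1 σ₀ ∈ T₂.1 ↔ mem (e P) 3598 = true))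
    (hT₃ : (∀ P : GalT K, P.1 σ₀ ∈ T₃.1 ↔ mem (e P) 924 = true))
    (hT₄ : (∀ P : GalT K, P.1 σ₀ ∈ T₄.1 ↔ mem (e P) 1806 = true))
    (hW₁ : (⟨1, ![E₀, T₁]⟩ : (m : ℕ) × (Fin (m + 1) → CMType K)) ∈ 𝒲)
    (hW₂ : (⟨1, ![E₀, T₂]⟩ : (m : ℕ) × (Fin (m + 1) → CMType K)) ∈ 𝒲)
    (hW₃ : (⟨1, ![E₁, T₃]⟩ : (m : ℕ) × (Fin (m + 1) → CMType K)) ∈ 𝒲)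
    (hW₄ : (⟨1, ![E₁, T₄]⟩ : (m : ℕ) × (Fin (m + 1) → CMType K)) ∈ 𝒲) (f : Face K) :
    lefChar f.corner (fun _ => ({σ₀} : Finset ((K : Type) →+* ℂ))) ∈ AddSubgroup.closure
      {a : Asym K | (∃ g ∈ 𝒮, ∃ σ : (K : Type) →+* ℂ,
          a = lefChar g.corner (fun _ => ({σ} : Finset ((K : Type) →+* ℂ)))) ∨
        ∃ w ∈ 𝒲, ∃ (p' : ℕ) (S' : Fin (w.1 + 1) → Finset ((K : Type) →+* ℂ)),
          IsHodgeWeight w.2 p' S' ∧ a = lefChar w.2 S'} := by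
  obtain ⟨R₃, hc₃, hp₃, hq₃⟩ := exists_face_reads Γ e hmul hconj σ₀ (r := (455, 9, 576))
    (by decide +kernel)
  obtain ⟨R₅, hc₅, hp₅, hq₅⟩ := exists_face_reads Γ e hmul hconj σ₀ (r := (455, 18, 36))
    (by decide +kernel)
  obtain ⟨R₆, hc₆, hp₆, hq₆⟩ := exists_face_reads Γ e hmul hconj σ₀ (r := (455, 18, 1152))
    (by decide +kernel)
  obtain ⟨R₇, hc₇, hp₇, hq₇⟩ := exists_face_reads Γ e hmul hconj σ₀ (r := (462, 36, 1152))
    (by decide +kernel)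
  have h8 := hgen_duodecicDihedral K e hmul hconj σ₀ (insert R₃ (insert R₅ (insert R₆ (insert R₇ 𝒮))))
    ⟨R₁, Set.mem_insert_of_mem _ (Set.mem_insert_of_mem _ (Set.mem_insert_of_mem _ (Set.mem_insert_of_mem _ (hR₁S)))), hR₁⟩
    ⟨R₂, Set.mem_insert_of_mem _ (Set.mem_insert_of_mem _ (Set.mem_insert_of_mem _ (Set.mem_insert_of_mem _ (hR₂S)))), hR₂⟩
    ⟨R₃, Set.mem_insert _ _, reads_of_code e σ₀ R₃.Φ hc₃, hp₃, hq₃⟩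
    ⟨R₄, Set.mem_insert_of_mem _ (Set.mem_insert_of_mem _ (Set.mem_insert_of_mem _ (Set.mem_insert_of_mem _ (hR₄S)))), hR₄⟩
    ⟨R₅, Set.mem_insert_of_mem _ (Set.mem_insert _ _), reads_of_code e σ₀ R₅.Φ hc₅, hp₅, hq₅⟩
    ⟨R₆, Set.mem_insert_of_mem _ (Set.mem_insert_of_mem _ (Set.mem_insert _ _)), reads_of_code e σ₀ R₆.Φ hc₆, hp₆, hq₆⟩
    ⟨R₇, Set.mem_insert_of_mem _ (Set.mem_insert_of_mem _ (Set.mem_insert_of_mem _ (Set.mem_insert _ _))), reads_of_code e σ₀ R₇.Φ hc₇, hp₇, hq₇⟩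
    ⟨R₈, Set.mem_insert_of_mem _ (Set.mem_insert_of_mem _ (Set.mem_insert_of_mem _ (Set.mem_insert_of_mem _ (hR₈S)))), hR₈⟩ f
  refine ((AddSubgroup.closure_le _).mpr ?_) h8
  rintro a ⟨g, hg, σ, rfl⟩
  simp only [Set.mem_insert_iff] at hg
  rcases hg with rfl | rfl | rfl | rfl | hg'
  · exact lefChar_corner_mem_closure_known_of_weightRel_mem 𝒮 𝒲 _ σ₀
      (weightRel_R₃_mem_span_known e hmul hconj σ₀ 𝒮 𝒲 R₁ R₂ R₄ R₈ hR₁S hR₂S hR₄S hR₈S hR₁ hR₂ hR₄ hR₈ _ ⟨hc₃, hp₃, hq₃⟩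
        E₁ T₃ T₄ hE₁ hT₃ hT₄ hW₃ hW₄) σ
  · exact lefChar_corner_mem_closure_known_of_weightRel_mem 𝒮 𝒲 _ σ₀
      (weightRel_R₅_mem_span_known e hmul hconj σ₀ 𝒮 𝒲 R₁ R₂ R₄ R₈ hR₁S hR₂S hR₄S hR₈S hR₁ hR₂ hR₄ hR₈ _ ⟨hc₅, hp₅, hq₅⟩
        E₀ E₁ T₁ T₂ T₃ T₄ hE₀ hE₁ hT₁ hT₂ hT₃ hT₄ hW₁ hW₂ hW₃ hW₄) σ
  · exact lefChar_corner_mem_closure_known_of_weightRel_mem 𝒮 𝒲 _ σ₀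
      (weightRel_R₆_mem_span_known e hmul hconj σ₀ 𝒮 𝒲 R₁ R₂ R₄ R₈ hR₁S hR₂S hR₄S hR₈S hR₁ hR₂ hR₄ hR₈ _ ⟨hc₆, hp₆, hq₆⟩
        E₀ E₁ T₁ T₃ T₄ hE₀ hE₁ hT₁ hT₃ hT₄ hW₁ hW₃ hW₄) σ
  · exact lefChar_corner_mem_closure_known_of_weightRel_mem 𝒮 𝒲 _ σ₀
      (weightRel_R₇_mem_span_known e hmul hconj σ₀ 𝒮 𝒲 R₁ R₂ R₄ R₈ hR₁S hR₂S hR₄S hR₈S hR₁ hR₂ hR₄ hR₈ _ ⟨hc₇, hp₇, hq₇⟩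
        E₁ T₃ hE₁ hT₃ hW₃) σ
  · exact AddSubgroup.subset_closure (Or.inl ⟨g, hg', σ, rfl⟩)

/-! ## §4 FIELD CLOSURE from 4 face periods and the Markman fourfold column -/

/-- **FIELD CLOSURE, type `D₆` (`DihedralGroup 6`, `c = r 3`) — 4 face periods + 4 known products (headline).** `K` a Galois CM field with an
enumeration `e : GalT K ≃ Fin 12` of its Galois translates multiplicative for b30's table, `e conjT = 3`; `σ₀` a base embedding; faces
`R₁`, `R₂`, `R₄`, `R₈` of `K` READING AS `(455;9,18)`, `(455;9,36)`, `(455;9,1152)`, `(469;9,36)`; CM types `E₀`, `E₁`, `T₁`, `T₂`, `T₃`, `T₄` of `K` reading as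
`2730`, `1386`, `952`, `3598`, `924`, `1806` (the `k_a`-curve types and sextic-threefold types, by code).  ONE period witness for each of the 4 faces on
the universe of record AND the Hodge conjecture for the 4 tree products `cmProdAV K cmAbelianVarietyRealised_holds 1 ![E_a, T]` of the weights
(Weil fourfolds `E_a × T` up to isogeny and powers; supplied modulo Markman's fourfold theorem by seat b07's
`InducedCurveThreefold.hodgeConjectureFor_cmProdAV_inducedCMType_pair_of_markman` once the types are presented as induced types) imply the
Hodge conjecture, in every codimension, for every complex abelian variety dominated by a finite product of abelian varieties realising CM
types of CM fields embeddable in `K`.  (FRAMING: conditional on these 4 face periods and on `hHC₁…`; b23's landed theorem needs 8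
periods; `HC_CM` is not proved.) [cite: Shimura1998, §6.2 Theorem 3 and §6.1 Corollary of Theorem 2 (pp. 41–43)] [cite: Pohlmann1968, Thm. 1]
[cite: Milne1999LefschetzClasses, Thm. 3.2 and Cor. 4.5] [cite: MumfordAV1970, §19 Thm. 1 and p. 169] -/
theorem hodgeConjectureFor_of_avDominatedBy_isProductOf_of_facePeriods_of_hodgeConjectureFor_duodecicDihedral (K : CMField)
    [IsGalois ℚ K] (e : GalT K ≃ Fin 12) (hmul : ∀ P Q : GalT K, e (P * Q) = Γ.mul (e P) (e Q)) (hconj : e conjT = Γ.conj)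
    (σ₀ : (K : Type) →+* ℂ) (R₁ R₂ R₄ R₈ : Face K)
    (hR₁ : (∀ P : GalT K, P.1 σ₀ ∈ R₁.Φ.1 ↔ mem (e P) 455 = true) ∧
      Γ.placeMask (e (translate σ₀ R₁.p)) = 9 ∧ Γ.placeMask (e (translate σ₀ R₁.p')) = 18)
    (hR₂ : (∀ P : GalT K, P.1 σ₀ ∈ R₂.Φ.1 ↔ mem (e P) 455 = true) ∧
      Γ.placeMask (e (translate σ₀ R₂.p)) = 9 ∧ Γ.placeMask (e (translate σ₀ R₂.p')) = 36)
    (hR₄ : (∀ P : GalT K, P.1 σ₀ ∈ R₄.Φ.1 ↔ mem (e P) 455 = true) ∧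
      Γ.placeMask (e (translate σ₀ R₄.p)) = 9 ∧ Γ.placeMask (e (translate σ₀ R₄.p')) = 1152)
    (hR₈ : (∀ P : GalT K, P.1 σ₀ ∈ R₈.Φ.1 ↔ mem (e P) 469 = true) ∧
      Γ.placeMask (e (translate σ₀ R₈.p)) = 9 ∧ Γ.placeMask (e (translate σ₀ R₈.p')) = 36)
    (E₀ E₁ T₁ T₂ T₃ T₄ : CMType K)
    (hE₀ : (∀ P : GalT K, P.1 σ₀ ∈ E₀.1 ↔ mem (e P) 2730 = true))
    (hE₁ : (∀ P : GalT K, P.1 σ₀ ∈ E₁.1 ↔ mem (e P) 1386 = true))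
    (hT₁ : (∀ P : GalT K, P.1 σ₀ ∈ T₁.1 ↔ mem (e P) 952 = true))
    (hT₂ : (∀ P : GalT K, P.1 σ₀ ∈ T₂.1 ↔ mem (e P) 3598 = true))
    (hT₃ : (∀ P : GalT K, P.1 σ₀ ∈ T₃.1 ↔ mem (e P) 924 = true))
    (hT₄ : (∀ P : GalT K, P.1 σ₀ ∈ T₄.1 ↔ mem (e P) 1806 = true))
    (hHC₁ : HodgeConjectureFor (cmProdAV K cmAbelianVarietyRealised_holds 1 ![E₀, T₁]).dim
      (cmProdAV K cmAbelianVarietyRealised_holds 1 ![E₀, T₁]).X)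
    (hHC₂ : HodgeConjectureFor (cmProdAV K cmAbelianVarietyRealised_holds 1 ![E₀, T₂]).dim
      (cmProdAV K cmAbelianVarietyRealised_holds 1 ![E₀, T₂]).X)
    (hHC₃ : HodgeConjectureFor (cmProdAV K cmAbelianVarietyRealised_holds 1 ![E₁, T₃]).dim
      (cmProdAV K cmAbelianVarietyRealised_holds 1 ![E₁, T₃]).X)
    (hHC₄ : HodgeConjectureFor (cmProdAV K cmAbelianVarietyRealised_holds 1 ![E₁, T₄]).dim
      (cmProdAV K cmAbelianVarietyRealised_holds 1 ![E₁, T₄]).X)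
    (h₁ : ∃ ι₁ : K →+* ℂ, R₁.Admissible ι₁ ∧ ∃ (V : HermSpace3 K ι₁) (σ : K →+* ℂ),
      (Model.picardCMUniverse exists_isReal_hodgeModel_holds hodgePQ_independent_of_hodgeModel_holds
        BallQuotient.ballQuotientUniformised_holds cmAbelianVarietyRealised_holds).PeriodNV ι₁ V K R₁.psi σ)
    (h₂ : ∃ ι₁ : K →+* ℂ, R₂.Admissible ι₁ ∧ ∃ (V : HermSpace3 K ι₁) (σ : K →+* ℂ),
      (Model.picardCMUniverse exists_isReal_hodgeModel_holds hodgePQ_independent_of_hodgeModel_holds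
        BallQuotient.ballQuotientUniformised_holds cmAbelianVarietyRealised_holds).PeriodNV ι₁ V K R₂.psi σ)
    (h₄ : ∃ ι₁ : K →+* ℂ, R₄.Admissible ι₁ ∧ ∃ (V : HermSpace3 K ι₁) (σ : K →+* ℂ),
      (Model.picardCMUniverse exists_isReal_hodgeModel_holds hodgePQ_independent_of_hodgeModel_holds
        BallQuotient.ballQuotientUniformised_holds cmAbelianVarietyRealised_holds).PeriodNV ι₁ V K R₄.psi σ)
    (h₈ : ∃ ι₁ : K →+* ℂ, R₈.Admissible ι₁ ∧ ∃ (V : HermSpace3 K ι₁) (σ : K →+* ℂ),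
      (Model.picardCMUniverse exists_isReal_hodgeModel_holds hodgePQ_independent_of_hodgeModel_holds
        BallQuotient.ballQuotientUniformised_holds cmAbelianVarietyRealised_holds).PeriodNV ι₁ V K R₈.psi σ)
    {P A : AbelianVariety ℂ} (hP : AbelianVariety.IsProductOf (fun B : AbelianVariety ℂ =>
      ∃ (E : Type) (_ : Field E) (_ : NumberField E) (_ : IsCMField E) (_ : E →+* (K : Type)) (Φ : CMType E)
        (ι : 𝓞 E →+* End B) (θ : E →+* Module.End ℂ (complexBetti B.X 1)),
        IsCMTypeRealisation Φ B ι θ) P)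
    (hA : AVDominatedBy A P) : HodgeConjectureFor A.dim A.X :=
  hodgeConjectureFor_of_avDominatedBy_isProductOf_of_exists_facePeriod_of_hodgeConjectureFor_on K
    ((show 6 ≤ 12 by decide).trans_eq (FaceCensus.eq_finrank_of_enum e)) {R₁, R₂, R₄, R₈}
    {(⟨1, ![E₀, T₁]⟩ : (m : ℕ) × (Fin (m + 1) → CMType K)), (⟨1, ![E₀, T₂]⟩ : (m : ℕ) × (Fin (m + 1) → CMType K)), (⟨1, ![E₁, T₃]⟩ : (m : ℕ) × (Fin (m + 1) → CMType K)), (⟨1, ![E₁, T₄]⟩ : (m : ℕ) × (Fin (m + 1) → CMType K))}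
    (fun w hw => by
      simp only [Set.mem_insert_iff, Set.mem_singleton_iff] at hw
      rcases hw with rfl | rfl | rfl | rfl
      · exact hHC₁
      · exact hHC₂
      · exact hHC₃
      · exact hHC₄) σ₀
    (hgen_duodecicDihedral_markman K e hmul hconj σ₀ {R₁, R₂, R₄, R₈} _ R₁ R₂ R₄ R₈
      (by simp) hR₁ (by simp) hR₂ (by simp) hR₄ (by simp) hR₈
      E₀ E₁ T₁ T₂ T₃ T₄ hE₀ hE₁ hT₁ hT₂ hT₃ hT₄
      (by simp) (by simp) (by simp) (by simp))
    (fun f hf => by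
      simp only [Set.mem_insert_iff, Set.mem_singleton_iff] at hf
      rcases hf with rfl | rfl | rfl | rfl
      · exact h₁
      · exact h₂
      · exact h₄
      · exact h₈) hP hA

end Summit.HodgeConjecture.CorCM.DuodecicFaceTransport.DihedralMarkman

end
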